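import Summits.QuantumFields.QCD.Theorems.QuarksAsStableActionStableActionBridgeStubEigenRayleigh
import Summits.QuantumFields.QCD.Theorems.QuarksAsStableActionStableActionBridgeStubRayleighLeOfEigenLe
import Summits.QuantumFields.QCD.Theorems.QuarksAsStableActionStableActionBridgeTransferLevelBounds
import Summits.QuantumFields.QCD.Theorems.QuarksAsStableActionStableActionBridgeTransferLevelOrder
import Summits.QuantumFields.QCD.Theorems.QuarksAsStableActionStableActionBridgeTransferPositivity
import HarnessLib

/-!
# Stub `stub_levelZero_eq_eigenmax` of line `twisted_trace_transfer`
# for crux `QuarksAsStableAction.StableActionBridge` (item stmt-QuantumFields-9737)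

This file proves the registered stub `stub_levelZero_eq_eigenmax` (sub-goal D3 of step E3, wave 3, of
the lead skeleton of line `twisted_trace_transfer`): **the top min–max level of the tree is the top
eigenvalue of the honest transfer operator.**

Step E3 realises Lüscher's QCD transfer matrix (Lüscher, CMP 54 (1977); Smit, *Introduction to Quantum
Fields on a Lattice*, §6.5 (6.87)) as a compact self-adjoint integral operator `A` on `L²(Y, ρ)`,
`Y = SU(3)^{E₃} × Finset(modes)`, `ρ = Haar ⊗ count`, with the Hermitian kernel
`k((U,s),(U',s')) = (R(U) B(U,U') R(U'))_{s s'}` (`R` a continuous pointwise Hermitian square root of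
Smit's `T̂_F(U) = fermionSliceOp U mq`, `B` the Gauss-averaged Wilson bond kernel), while the tree's top
level is the unconstrained supremum `qcdTransferLevel Nf S β mq 0 = sup {R(Ψ) : Ψ ∈ T}` of the Rayleigh
quotient `transferRayleigh` over the trial set `T = {Ψ ∈ transferCore | 𝔫(Ψ,Ψ) ≠ 0}`
(`qcdTransferLevel_zero`).  The stub: for `β ≥ 0`, `m_f > −1`, a self-adjoint `A` given a.e. by `k` with
a Hilbert basis of eigenvectors `A bᵢ = λᵢ bᵢ` (`λᵢ ∈ ℝ`),
* every `λᵢ` lies in `[0, qcdTransferLevel Nf S β mq 0]`, and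
* the level is the LEAST upper bound of the `λᵢ`.

## Proof

* If `λᵢ = 0` the first clause is `0 ≤ λ₀` (`Sketch.TransferLevelOrder.qcdTransferLevel_nonneg`).  If
  `λᵢ ≠ 0`, then `bᵢ ≠ 0` (`‖bᵢ‖ = 1`) and the landed sibling `stub_eigen_rayleigh` produces `Ψ ∈ T` with
  `transferRayleigh β mq Ψ = λᵢ`; hence `0 ≤ λᵢ` (`Sketch.transferRayleigh_nonneg`, `Ψ` being continuous)
  and `λᵢ ≤ sup_T R = λ₀` (`le_csSup`, the Rayleigh quotient being bounded above on `T`,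
  `Sketch.TransferLevelOrder.bddAbove_transferRayleigh_image`).
* Leastness: if `λᵢ ≤ Λ` for all `i`, the landed sibling `stub_rayleigh_le_of_eigen_le` gives `R(Ψ) ≤ Λ`
  on `T`; `T` contains the vacuum wave (`Sketch.TransferLevelBounds.vacuum_mem_trialSet`), so
  `λ₀ = sup_T R ≤ Λ` (`csSup_le`).

Pure theorem file (no definitions, no notation, no helpers).

[cite: ReedSimonIV1978, Thm XIII.1] [cite: Luscher1977, pp. 283–292] [cite: Smit2023, §6.5 (6.87)]
-/

noncomputable section

namespace Summit.QuantumFields.QCD.Cruxes.StableActionBridge.TwistedTraceTransfer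

open MeasureTheory
open scoped InnerProductSpace ComplexConjugate Matrix BigOperators
open Literature.MathematicalPhysics.QuantumFieldTheory Literature.MathematicalPhysics.QuantumLattice
open Literature.Probability.LatticeModels (TorusSite)

/-- **Sub-goal D3 of step E3 (registered stub `stub_levelZero_eq_eigenmax`): the top min–max level of
the tree IS the top eigenvalue of the honest transfer operator.**  For `β ≥ 0`, `m_f > −1`, the
scalarised kernel `k((U,s),(U',s')) = (R(U) B(U,U') R(U'))_{s s'}`, a self-adjoint `A` on
`L²(Haar ⊗ count)` with the a.e. kernel formula and a Hilbert basis of eigenvectors `A bᵢ = λᵢ bᵢ`: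
every `λᵢ` lies in `[0, qcdTransferLevel N_f S β m 0]` (`λᵢ ≠ 0` is a Rayleigh value of the core,
`stub_eigen_rayleigh`; `transferRayleigh_nonneg`; `le_csSup`) and the level is the LEAST such bound
(`qcdTransferLevel_zero`, `stub_rayleigh_le_of_eigen_le`, `csSup_le`, the trial set containing the
vacuum). [cite: ReedSimonIV1978, Thm XIII.1] [cite: Luscher1977, pp. 283–292] -/
theorem stub_levelZero_eq_eigenmax : ∀ (Nf S : ℕ) [NeZero S] (β : ℝ) (mq : Fin Nf → ℝ), 0 ≤ β → (∀ f, -1 < mq f) →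
    ∀ R : GaugeConfig 3 S (Matrix.specialUnitaryGroup (Fin 3) ℂ) → Matrix (Finset (SliceFermiIdx Nf S)) (Finset (SliceFermiIdx Nf S)) ℂ,
    Continuous R → (∀ U, (R U)ᴴ = R U ∧ R U * R U = fermionSliceOp U mq) →
    ∀ k : GaugeConfig 3 S (Matrix.specialUnitaryGroup (Fin 3) ℂ) × Finset (SliceFermiIdx Nf S) → GaugeConfig 3 S (Matrix.specialUnitaryGroup (Fin 3) ℂ) × Finset (SliceFermiIdx Nf S) → ℂ,
    (∀ y y', k y y' = (R y.1 * (Matrix.of fun a c => ∫ g : TorusSite 3 S → (Matrix.specialUnitaryGroup (Fin 3) ℂ),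
          (gaugeSliceKernel β y.1 (gaugeTransform g y'.1) : ℂ) * @fockGaugeAct Nf S _ g a c
            ∂(Measure.pi fun _ => haarProbability (Matrix.specialUnitaryGroup (Fin 3) ℂ))) * R y'.1) y.2 y'.2) →
    ∀ A : Lp ℂ 2 ((sliceHaar S).prod (Measure.count : Measure (Finset (SliceFermiIdx Nf S)))) →L[ℂ]
        Lp ℂ 2 ((sliceHaar S).prod (Measure.count : Measure (Finset (SliceFermiIdx Nf S)))),
      IsSelfAdjoint A →
      (∀ φ : Lp ℂ 2 ((sliceHaar S).prod (Measure.count : Measure (Finset (SliceFermiIdx Nf S)))),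
        (A φ : GaugeConfig 3 S (Matrix.specialUnitaryGroup (Fin 3) ℂ) × Finset (SliceFermiIdx Nf S) → ℂ)
          =ᵐ[(sliceHaar S).prod (Measure.count : Measure (Finset (SliceFermiIdx Nf S)))]
          fun y => ∫ y', k y y' * φ y' ∂((sliceHaar S).prod (Measure.count : Measure (Finset (SliceFermiIdx Nf S))))) →
    ∀ (ι : Type) (b : HilbertBasis ι ℂ (Lp ℂ 2 ((sliceHaar S).prod (Measure.count : Measure (Finset (SliceFermiIdx Nf S))))))
      (lam : ι → ℝ), (∀ i, A (b i) = (lam i : ℂ) • (b i : Lp ℂ 2 ((sliceHaar S).prod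
        (Measure.count : Measure (Finset (SliceFermiIdx Nf S)))))) →
    (∀ i, 0 ≤ lam i ∧ lam i ≤ qcdTransferLevel Nf S β mq 0) ∧
    (∀ Λ : ℝ, (∀ i, lam i ≤ Λ) → qcdTransferLevel Nf S β mq 0 ≤ Λ) := by
  intro Nf S _ β mq hβ hm R hRc hR k hk A hA hAk ι b lam hb
  -- the Rayleigh quotient is bounded above on the trial set `T = {Ψ ∈ core | 𝔫(Ψ,Ψ) ≠ 0}`
  have hT : BddAbove (transferRayleigh β mq ''
      {Ψ : SliceWave Nf S | Ψ ∈ transferCore Nf S ∧ fermionWeightForm mq Ψ Ψ ≠ 0}) :=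
    Sketch.TransferLevelOrder.bddAbove_transferRayleigh_image hβ hm
      Sketch.TransferLevelBounds.continuous_of_mem_trialSet
  refine ⟨fun i => ?_, fun Λ hΛ => ?_⟩
  · by_cases hli : lam i = 0
    · rw [hli]
      exact ⟨le_rfl, Sketch.TransferLevelOrder.qcdTransferLevel_nonneg hβ hm 0⟩
    · -- `bᵢ ≠ 0`, so `λᵢ` is a Rayleigh value of the trial set
      obtain ⟨Ψ, hΨ, hn, -, -, hRay⟩ := stub_eigen_rayleigh Nf S β mq hm R hRc hR k hk A hAk (b i) (lam i)
        hli (b.orthonormal.ne_zero i) (hb i)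
      refine ⟨?_, ?_⟩
      · rw [← hRay]
        exact Sketch.transferRayleigh_nonneg Nf S β mq hβ hm Ψ hΨ.1
      · rw [← hRay, qcdTransferLevel_zero]
        exact le_csSup hT ⟨Ψ, ⟨hΨ, hn⟩, rfl⟩
  · rw [qcdTransferLevel_zero]
    refine csSup_le ((Set.nonempty_of_mem (Sketch.TransferLevelBounds.vacuum_mem_trialSet
      (Nf := Nf) (S := S) hm)).image _) ?_
    rintro _ ⟨Ψ, ⟨hΨ, hn⟩, rfl⟩
    exact stub_rayleigh_le_of_eigen_le Nf S β mq hm R hRc hR k hk A hA hAk ι b lam hb Λ hΛ Ψ hΨ hn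

end Summit.QuantumFields.QCD.Cruxes.StableActionBridge.TwistedTraceTransfer

end
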